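import Literature.Combinatorics.Additive.TripleProductProperty
import Summits.MatrixMultiplication.MatrixMultiplication.Theorems.SnSubsetDichotomyThresholdSubsetTriplesChainDefs

/-!
# `SnSubsetDichotomy.ThresholdSubsetTriples` — stub `stub_designRuleR1`, certificate decided on the finite core

Crux `stmt-MatrixMultiplication-10882` (`SnSubsetDichotomy.ThresholdSubsetTriples`), line
`interleaved-subsignature-ascent`, registered stub `stub_designRuleR1` (cross-level design rule R1 of census
c3b §3; siege seat k24, variation "certificate / decide on the finite core").

**Statement.**  Token `N`; lower sets `L₁ ∋ a, a'` whose quotient `a a'⁻¹` is the 3-cycle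
`swap x z * swap x y` (`x ↦ y ↦ z ↦ x`), `L₂ ∋ b`, `L₃ ∋ c`; directions `x ∈ E₁`, `y, z ∈ E₂`, `e ∈ E₃`;
`x, y, z` pairwise distinct and `y, z ≠ N`.  Then the top-extended triple
`(starPiece E₁ N * L₁, starPiece E₂ N * L₂, starPiece E₃ N * L₃)` does not have the triple product property.

**Proof shape (this file's variation).**
1. `not_tpp_of_certificate` — a REFUTATION CERTIFICATE for the TPP of `(S, T, U)` is a quintuple
   `s, s' ∈ S`, `t, t' ∈ T`, `u ∈ U` with `s s'⁻¹ · t t'⁻¹ = 1` and `s ≠ s'` (take `u' = u`).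
2. The certificate: `s = swap(x,N) a`, `s' = swap(x,N) a'`, `t = swap(y,N) b`, `t' = swap(z,N) b`,
   `u = swap(e,N) c`.  Its relation is, after `hq`, the six-letter star word
   `swap(x,N) swap(x,z) swap(x,y) swap(x,N) · swap(y,N) swap(z,N)` on the CORE `{x, y, z, N}`.
3. `core_four_points` / `core_three_points` — the word is DECIDED (`decide`) to be trivial on the abstract
   core `Perm (Fin 4)` (points `0,1,2,3` for `x,y,z,N`), resp. `Perm (Fin 3)` in the degenerate case `x = N`
   (allowed by the signature: then `swap x N` is the identity letter), and transported to `α` along the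
   embedding `![x, y, z, N]` (resp. `![N, y, z]`) by the homomorphism `Equiv.Perm.viaEmbeddingHom`, which
   carries transpositions to transpositions (`viaEmbeddingHom_swap`).
4. `s ≠ s'`: otherwise `a = a'` and the 3-cycle would be `1`, but it moves `x` to `y`.

Only Mathlib (`Equiv.Perm.viaEmbeddingHom`, `List.nodup_ofFn`, swap algebra), the tree's
`TripleProductProperty` (Cohn–Umans 2003 Def. 2.1) and the line vocabulary `starPiece` / `mem_starPiece`.
An independent proof of the same registered stub (first landed as `…ThresholdSubsetTriples.stub_designRuleR1`
by direct conjugation algebra) — hence the sub-namespace `DesignRuleR1FiniteCore`. [folklore]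
-/

-- `Summit.<Summit>.<Problem>` is the tree's mandated summit-side namespace; for this single-conjunct summit the
-- two components coincide, so the file silences `dupNamespace` (same as the vocabulary file it imports).
set_option linter.dupNamespace false
set_option autoImplicit false

namespace Summit.MatrixMultiplication.MatrixMultiplication.Theorems.ThresholdSubsetTriples

open scoped Pointwise
open Literature.Combinatorics.Additive

namespace DesignRuleR1FiniteCore

/-! ## 1. Certificates refuting the triple product property -/

/-- **Refutation certificate for the TPP.**  If `s, s' ∈ S`, `t, t' ∈ T`, `u ∈ U` satisfy
`s s'⁻¹ (t t'⁻¹) = 1` with `s ≠ s'`, then `(S, T, U)` fails the triple product property (instantiate the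
definition at `u' = u`). [folklore] -/
theorem not_tpp_of_certificate {G : Type*} [Group G] {S T U : Finset G} {s s' t t' u : G}
    (hs : s ∈ S) (hs' : s' ∈ S) (ht : t ∈ T) (ht' : t' ∈ T) (hu : u ∈ U)
    (hrel : s * s'⁻¹ * (t * t'⁻¹) = 1) (hne : s ≠ s') : ¬ TripleProductProperty S T U :=
  fun hT => hne (hT s hs s' hs' t ht t' ht' u hu u hu (by rw [hrel, mul_inv_cancel, mul_one])).1

/-! ## 2. Transport from the abstract finite core -/

/-- The homomorphism `Equiv.Perm.viaEmbeddingHom f` carries a transposition to a transposition: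
`f_* (swap i j) = swap (f i) (f j)`. [folklore] -/
theorem viaEmbeddingHom_swap {κ β : Type*} [DecidableEq κ] [DecidableEq β] (f : κ ↪ β) (i j : κ) :
    Equiv.Perm.viaEmbeddingHom f (Equiv.swap i j) = Equiv.swap (f i) (f j) := by
  ext w
  rw [Equiv.Perm.viaEmbeddingHom_apply]
  by_cases hw : w ∈ Set.range f
  · obtain ⟨v, rfl⟩ := hw
    rw [Equiv.Perm.viaEmbedding_apply, Equiv.swap_apply_def, Equiv.swap_apply_def]
    simp only [EmbeddingLike.apply_eq_iff_eq]
    split_ifs <;> rfl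
  · rw [Equiv.Perm.viaEmbedding_apply_of_notMem _ _ _ hw, Equiv.swap_apply_of_ne_of_ne]
    · rintro rfl
      exact hw ⟨i, rfl⟩
    · rintro rfl
      exact hw ⟨j, rfl⟩

/-- **The finite core, decided (generic case).**  On four abstract points `0, 1, 2, 3` (standing for
`x, y, z, N`) the pushed star word of the R1 certificate,
`swap 0 3 · (swap 0 2 · swap 0 1) · swap 0 3 · (swap 1 3 · swap 2 3)`, is the identity of `Perm (Fin 4)`.
[folklore] -/
theorem core_four_points :
    Equiv.swap (0 : Fin 4) 3 * (Equiv.swap 0 2 * Equiv.swap 0 1) * Equiv.swap 0 3 *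
      (Equiv.swap 1 3 * Equiv.swap 2 3) = 1 := by
  decide

/-- **The finite core, decided (degenerate case `x = N`).**  On three abstract points `0, 1, 2` (for
`N = x, y, z`) the word `swap 0 0 · (swap 0 2 · swap 0 1) · swap 0 0 · (swap 1 0 · swap 2 0)` is the
identity of `Perm (Fin 3)`. [folklore] -/
theorem core_three_points :
    Equiv.swap (0 : Fin 3) 0 * (Equiv.swap 0 2 * Equiv.swap 0 1) * Equiv.swap 0 0 *
      (Equiv.swap 1 0 * Equiv.swap 2 0) = 1 := by
  decide

/-- Transport of `core_four_points` along an embedding `f : Fin 4 ↪ β`. [folklore] -/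
theorem core_transport_four {β : Type*} [DecidableEq β] (f : Fin 4 ↪ β) :
    Equiv.swap (f 0) (f 3) * (Equiv.swap (f 0) (f 2) * Equiv.swap (f 0) (f 1)) * Equiv.swap (f 0) (f 3) *
      (Equiv.swap (f 1) (f 3) * Equiv.swap (f 2) (f 3)) = 1 := by
  have h := congrArg (Equiv.Perm.viaEmbeddingHom f) core_four_points
  simpa only [map_mul, map_one, viaEmbeddingHom_swap] using h

/-- Transport of `core_three_points` along an embedding `f : Fin 3 ↪ β`. [folklore] -/
theorem core_transport_three {β : Type*} [DecidableEq β] (f : Fin 3 ↪ β) :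
    Equiv.swap (f 0) (f 0) * (Equiv.swap (f 0) (f 2) * Equiv.swap (f 0) (f 1)) * Equiv.swap (f 0) (f 0) *
      (Equiv.swap (f 1) (f 0) * Equiv.swap (f 2) (f 0)) = 1 := by
  have h := congrArg (Equiv.Perm.viaEmbeddingHom f) core_three_points
  simpa only [map_mul, map_one, viaEmbeddingHom_swap] using h

/-- **The certificate's relation holds.**  For `x, y, z` pairwise distinct and `y, z ≠ N` (but possibly
`x = N`), `swap(x,N) (swap(x,z) swap(x,y)) swap(x,N) · (swap(y,N) swap(z,N)) = 1` in `Perm β`: the generic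
case is `core_four_points` transported along `![x, y, z, N]`, the degenerate case `x = N` is
`core_three_points` transported along `![N, y, z]`. [folklore] -/
theorem witness_word_eq_one {β : Type*} [DecidableEq β] (N x y z : β) (hxy : x ≠ y) (hxz : x ≠ z)
    (hyz : y ≠ z) (hyN : y ≠ N) (hzN : z ≠ N) :
    Equiv.swap x N * (Equiv.swap x z * Equiv.swap x y) * Equiv.swap x N *
      (Equiv.swap y N * Equiv.swap z N) = 1 := by
  by_cases hxN : x = N
  · rw [hxN]
    have hinj : Function.Injective ![N, y, z] := by
      rw [← List.nodup_ofFn]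
      simp [List.ofFn_succ, hyz, hyN.symm, hzN.symm]
    exact core_transport_three ⟨_, hinj⟩
  · have hinj : Function.Injective ![x, y, z, N] := by
      rw [← List.nodup_ofFn]
      simp [List.ofFn_succ, hxy, hxz, hyz, hyN, hzN, hxN]
    exact core_transport_four ⟨_, hinj⟩

/-- The 3-cycle `swap x z * swap x y` (`x ↦ y ↦ z ↦ x`) is not the identity: it moves `x` to `y`
(needs only `x ≠ y ≠ z`). [folklore] -/
theorem swap_mul_swap_ne_one {β : Type*} [DecidableEq β] {x y z : β} (hxy : x ≠ y) (hyz : y ≠ z) :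
    Equiv.swap x z * Equiv.swap x y ≠ 1 := by
  intro h1
  have h2 := congrArg (fun π : Equiv.Perm β => π x) h1
  simp only [Equiv.Perm.mul_apply, Equiv.swap_apply_left, Equiv.Perm.one_apply,
    Equiv.swap_apply_of_ne_of_ne hxy.symm hyz] at h2
  exact hxy h2.symm

end DesignRuleR1FiniteCore

/-! ## 3. The stub -/

namespace DesignRuleR1FiniteCore

/-- **Design rule R1 (registered stub `stub_designRuleR1` of crux `stmt-MatrixMultiplication-10882`, census
c3b §3), proved by a refutation certificate decided on the finite core.**  Token `N`; lower sets `L₁ ∋ a, a'`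
with `a a'⁻¹ = swap x z * swap x y` the 3-cycle `x ↦ y ↦ z ↦ x`, `L₂ ∋ b`, `L₃ ∋ c`; directions `x ∈ E₁`,
`y, z ∈ E₂`, `e ∈ E₃`; `x, y, z` distinct and `y, z ≠ N`.  Then
`(starPiece E₁ N * L₁, starPiece E₂ N * L₂, starPiece E₃ N * L₃)` is NOT a TPP triple: the certificate
`s = swap(x,N) a`, `s' = swap(x,N) a'`, `t = swap(y,N) b`, `t' = swap(z,N) b`, `u = u' = swap(e,N) c` has
relation the star word of `witness_word_eq_one` (trivial — decided on `Fin 4` / `Fin 3` and transported)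
while `s ≠ s'` (`swap_mul_swap_ne_one`). [folklore] -/
theorem stub_designRuleR1 {α : Type*} [DecidableEq α] [Fintype α] (N x y z e : α) (E₁ E₂ E₃ : Finset α) (L₁ L₂ L₃ : Finset (Equiv.Perm α)) (a a' b c : Equiv.Perm α) (ha : a ∈ L₁) (ha' : a' ∈ L₁) (hb : b ∈ L₂) (hc : c ∈ L₃) (hq : a * a'⁻¹ = Equiv.swap x z * Equiv.swap x y) (hx : x ∈ E₁) (hy : y ∈ E₂) (hz : z ∈ E₂) (he : e ∈ E₃) (hxy : x ≠ y) (hxz : x ≠ z) (hyz : y ≠ z) (hyN : y ≠ N) (hzN : z ≠ N) : ¬ TripleProductProperty (starPiece E₁ N * L₁) (starPiece E₂ N * L₂) (starPiece E₃ N * L₃) := by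
  -- the certificate lies in the three classes
  have hs : Equiv.swap x N * a ∈ starPiece E₁ N * L₁ :=
    Finset.mul_mem_mul (mem_starPiece.2 ⟨x, hx, rfl⟩) ha
  have hs' : Equiv.swap x N * a' ∈ starPiece E₁ N * L₁ :=
    Finset.mul_mem_mul (mem_starPiece.2 ⟨x, hx, rfl⟩) ha'
  have ht : Equiv.swap y N * b ∈ starPiece E₂ N * L₂ :=
    Finset.mul_mem_mul (mem_starPiece.2 ⟨y, hy, rfl⟩) hb
  have ht' : Equiv.swap z N * b ∈ starPiece E₂ N * L₂ :=
    Finset.mul_mem_mul (mem_starPiece.2 ⟨z, hz, rfl⟩) hb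
  have hu : Equiv.swap e N * c ∈ starPiece E₃ N * L₃ :=
    Finset.mul_mem_mul (mem_starPiece.2 ⟨e, he, rfl⟩) hc
  -- its relation is the pushed star word on the core `{x, y, z, N}`, decided there
  have hrel : Equiv.swap x N * a * (Equiv.swap x N * a')⁻¹ *
      (Equiv.swap y N * b * (Equiv.swap z N * b)⁻¹) = 1 := by
    calc Equiv.swap x N * a * (Equiv.swap x N * a')⁻¹ * (Equiv.swap y N * b * (Equiv.swap z N * b)⁻¹)
        = Equiv.swap x N * (a * a'⁻¹) * Equiv.swap x N * (Equiv.swap y N * Equiv.swap z N) := by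
          simp only [mul_inv_rev, Equiv.swap_inv, mul_assoc, mul_inv_cancel_left]
      _ = 1 := by
          rw [hq]
          exact witness_word_eq_one N x y z hxy hxz hyz hyN hzN
  -- and its first coordinates differ, because the 3-cycle is not trivial
  have hne : Equiv.swap x N * a ≠ Equiv.swap x N * a' := by
    intro h
    refine swap_mul_swap_ne_one hxy hyz ?_
    rw [← hq, mul_left_cancel h, mul_inv_cancel]
  exact not_tpp_of_certificate hs hs' ht ht' hu hrel hne

end DesignRuleR1FiniteCore

end Summit.MatrixMultiplication.MatrixMultiplication.Theorems.ThresholdSubsetTriples
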